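import Literature.Probability.FitznerVanDerHofstad2017.SrwTwistCosPowRow
import Literature.Probability.FitznerVanDerHofstad2017.SrwTwistProductRowPerturbation
import HarnessLib

/-!
# The budget of ONE product cosine-power twisted seed: truncation + literals, and the m-uniform device

For the PRODUCT cosine-power twisted seeds `Tw^{Π_μ cos^{a_μ}}_{n+1}(m e_i; β)` to which every
weighted slice of the consumer interface reduces (`SrwTwistCosPowRow`, `SrwTwistDsinSlices`;
Fitzner–van der Hofstad, *NoBLE* (3.34)–(3.38), §5.1.1), this file states WHAT A KERNEL CERTIFICATE
DISCHARGES, in the two regimes of `m`: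

* `abs_srwTwist_prodCosPow_sub_prodRowObj_le` — for ANY literal coefficient tables
  `c' : Fin d → ℕ → ℂ`: `|Tw − Obj(c')| ≤` (row truncation at order `J`, in plain seeds;
  `abs_srwTwist_prodCosPow_sub_rowTrunc_le_sum_srwI`) `+` (coefficient substitution
  `2π iʲ J_j(β/d) ↦ c'_{μ,j}`, a multiple of the origin seed;
  `abs_prodCosPowRowObj_sub_le_incr_mul_srwI_zero`) — the product analogue of
  `abs_srwTwist_sub_rowObj_le` (`SrwTwistTruncationSeeds`); one-seed form
  `abs_srwTwist_prodCosPow_sub_prodRowObj_le_one_seed`;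
* `abs_srwTwist_prodCosPow_sub_besselJ_zero_pow_mul_le` — the `m`-UNIFORM device (`J = 0`) in
  closed form: for every `m` with `|m| ≥ M ≥ max_μ a_μ`,
  `|Tw^{Πcos^{a}}_{n+1}(m e_i; β) − J_0(β/d)^d · Tw^{Πcos^{a}}_{n+1}(·; 0)|`
  `≤ Σ_{k<d} C(d,k+1) (2δ_0(β/d))^{k+1} · srwI d (n+1) 0 ((M − a_max)(e_0+…+e_k))` — main term
  `J_0(β/d)^d` times the `β = 0` MASS of the product weight (node-independent,
  `srwTwist_zero_right_eq`; plain seeds), error in plain seeds, nothing depending on `m`.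

Everything is PROVED (standard axioms), `d`-generic and number-free; no definition, no named fact.
Epistemic status / lane: what-if / input-certification SUPPORT; nothing here is a certificate; no
statement at a specific dimension.

## References
* R. Fitzner, R. van der Hofstad, PTRF 169 (2017) 1041–1119, (3.34)–(3.38) p. 1071, §5.1.1 (5.2)–(5.5),
  §5.2 (5.9), (5.14) p. 1092. [FitznerVanDerHofstad2016NoBLE]
* NIST DLMF §10.35.2, §10.37, §10.14.4. [DLMF]
-/

noncomputable section

open MeasureTheory Set Filter Real
open scoped Topology Nat

namespace Literature.Probability.FitznerVanDerHofstad2017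

open Literature.Barriers.CriticalPhenomena
open Literature.Probability.LatticeModels (besselI)
open Literature.Analysis.FunctionSpaces (besselJ besselJ_zero_zero besselJ_succ_apply_zero)

variable {d : ℕ}

/-- At `β = 0` a twisted moment does not depend on the node: `Tw^{w}_n(x;0) = Tw^{w}_n(x';0)`
(the weight MASS `∫ w Ĉⁿ dP/(2π)^d`). [cite: FitznerVanDerHofstad2016NoBLE, (3.34) p. 1071] -/
theorem srwTwist_zero_right_eq (n : ℕ) (w : (Fin d → ℝ) → ℝ) (x x' : Fin d → ℤ) :
    srwTwist d n w x 0 = srwTwist d n w x' 0 := by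
  simp only [srwTwist, zero_mul, Real.cos_zero, mul_one]

/-! ### Truncation + literal substitution -/

/-- **What a weighted-slice kernel certificate discharges.** For `d ≥ 2n+3`, `m ≠ 0`, `|m| ≥ M`,
exponents `a_μ ≤ a_max ≤ (J+1)M` and ANY coefficient tables `c' : Fin d → ℕ → ℂ`
(in a kernel `c'_{μ,j} = 2π iʲ q_{μ,j}`, `q ∈ ℚ`):
`|Tw^{Π_μ cos^{a_μ}}_{n+1}(m e_i; β) − Obj(c')| ≤ Σ_{k<d} C(d,k+1)(2δ_J)^{k+1}·srwI d (n+1) 0 (c(e_0+…+e_k))`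
`+ (Π_μ(α'_μ+η_μ) − Π_μ α'_μ)/(2π)^d · srwI d (n+1) 0 0`, with `c = (J+1)M − a_max`,
`δ_J = Σ_{l≥0}|J_{l+J+1}(β/d)|`, `α'_μ = Σ_{j≤J} ε_j‖c'_{μ,j}‖`, `η_μ = Σ_{j≤J} ε_j‖2π iʲ J_j(β/d) − c'_{μ,j}‖`,
`Obj(c') = (n!)⁻¹(∫₀^∞ τⁿe^{-τ} Re Π_μ Σ_{j≤J} ε_j W^{(a_μ)}_j(τ/d) c'_{μ,j} dτ)/(2π)^d`.
[cite: FitznerVanDerHofstad2016NoBLE, (3.34)–(3.38) p. 1071, §5.1.1 (5.2)–(5.5); DLMF, 10.35.2, 10.14.4, 10.37] -/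
theorem abs_srwTwist_prodCosPow_sub_prodRowObj_le (n : ℕ) (hd : 2 * (n + 1) + 1 ≤ d) (i : Fin d)
    {m : ℤ} (hm : m ≠ 0) (β : ℝ) (a : Fin d → ℕ) (J M amax : ℕ) (hM : M ≤ m.natAbs)
    (ha : ∀ μ, a μ ≤ amax) (hamax : amax ≤ (J + 1) * M) (c' : Fin d → ℕ → ℂ) :
    |srwTwist d (n + 1) (fun k => ∏ μ, Real.cos (k μ) ^ a μ) (Pi.single i m) β
      - (n ! : ℝ)⁻¹ * (∫ τ in Ioi (0:ℝ), τ ^ n * (Real.exp (-τ) *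
        (∏ μ, ∑ j ∈ Finset.range (J + 1), (if j = 0 then (1 : ℂ) else 2)
          * ((∑ s ∈ Finset.range (a μ + 1), (((a μ).choose s : ℂ) / 2 ^ (a μ))
              * (besselI (j * m - ((2 * (s : ℤ) - (a μ : ℕ) : ℤ))) (τ / d) : ℂ)) * c' μ j)).re))
        / (2 * π) ^ d|
    ≤ (∑ k ∈ Finset.range d, (d.choose (k + 1) : ℝ)
        * (2 * ∑' l : ℕ, |besselJ (l + J + 1) (β / d)|) ^ (k + 1)
        * srwI d (n + 1) 0
            (fun μ : Fin d => if (μ : ℕ) < k + 1 then ((((J + 1) * M - amax : ℕ)) : ℤ) else 0))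
      + ((∏ μ, ((∑ j ∈ Finset.range (J + 1), (if j = 0 then (1 : ℝ) else 2) * ‖c' μ j‖)
            + ∑ j ∈ Finset.range (J + 1), (if j = 0 then (1 : ℝ) else 2)
                * ‖2 * π * Complex.I ^ j * (besselJ j (β / d) : ℂ) - c' μ j‖))
        - ∏ μ, ∑ j ∈ Finset.range (J + 1), (if j = 0 then (1 : ℝ) else 2) * ‖c' μ j‖) / (2 * π) ^ d
      * srwI d (n + 1) 0 (fun _ : Fin d => 0) := by
  have h1 := abs_srwTwist_prodCosPow_sub_rowTrunc_le_sum_srwI n hd i hm β a J M amax hM ha hamax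
  have h2 := abs_prodCosPowRowObj_sub_le_incr_mul_srwI_zero (d := d) n hd m J a
    (fun _ j => 2 * π * Complex.I ^ j * (besselJ j (β / d) : ℂ)) c'
  exact (abs_sub_le _ _ _).trans (add_le_add h1 h2)

/-- One-seed form of `abs_srwTwist_prodCosPow_sub_prodRowObj_le`: the truncation part coarsened to
`((1+2δ_J)^d − 1)·srwI d (n+1) 0 (c e_0)`. [cite: FitznerVanDerHofstad2016NoBLE, (3.34)–(3.38) p. 1071, §5.1.1 (5.2)–(5.5); DLMF, 10.35.2, 10.37] -/
theorem abs_srwTwist_prodCosPow_sub_prodRowObj_le_one_seed (n : ℕ) (hd : 2 * (n + 1) + 1 ≤ d)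
    (i : Fin d) {m : ℤ} (hm : m ≠ 0) (β : ℝ) (a : Fin d → ℕ) (J M amax : ℕ) (hM : M ≤ m.natAbs)
    (ha : ∀ μ, a μ ≤ amax) (hamax : amax ≤ (J + 1) * M) (c' : Fin d → ℕ → ℂ) :
    |srwTwist d (n + 1) (fun k => ∏ μ, Real.cos (k μ) ^ a μ) (Pi.single i m) β
      - (n ! : ℝ)⁻¹ * (∫ τ in Ioi (0:ℝ), τ ^ n * (Real.exp (-τ) *
        (∏ μ, ∑ j ∈ Finset.range (J + 1), (if j = 0 then (1 : ℂ) else 2)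
          * ((∑ s ∈ Finset.range (a μ + 1), (((a μ).choose s : ℂ) / 2 ^ (a μ))
              * (besselI (j * m - ((2 * (s : ℤ) - (a μ : ℕ) : ℤ))) (τ / d) : ℂ)) * c' μ j)).re))
        / (2 * π) ^ d|
    ≤ ((1 + 2 * ∑' l : ℕ, |besselJ (l + J + 1) (β / d)|) ^ d - 1)
        * srwI d (n + 1) 0
            (fun μ : Fin d => if (μ : ℕ) < 1 then ((((J + 1) * M - amax : ℕ)) : ℤ) else 0)
      + ((∏ μ, ((∑ j ∈ Finset.range (J + 1), (if j = 0 then (1 : ℝ) else 2) * ‖c' μ j‖)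
            + ∑ j ∈ Finset.range (J + 1), (if j = 0 then (1 : ℝ) else 2)
                * ‖2 * π * Complex.I ^ j * (besselJ j (β / d) : ℂ) - c' μ j‖))
        - ∏ μ, ∑ j ∈ Finset.range (J + 1), (if j = 0 then (1 : ℝ) else 2) * ‖c' μ j‖) / (2 * π) ^ d
      * srwI d (n + 1) 0 (fun _ : Fin d => 0) := by
  have h1 := abs_srwTwist_prodCosPow_sub_rowTrunc_le_incr_mul_srwI n hd i hm β a J M amax hM ha hamax
  have h2 := abs_prodCosPowRowObj_sub_le_incr_mul_srwI_zero (d := d) n hd m J a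
    (fun _ j => 2 * π * Complex.I ^ j * (besselJ j (β / d) : ℂ)) c'
  exact (abs_sub_le _ _ _).trans (add_le_add h1 h2)

/-! ### The `β = 0` mass and the `m`-uniform device for product slices (`J = 0`) -/

/-- The `J = 0` row product at coefficient `2π J_0(y)`: `Π_μ (Σ_{j<1} ε_j W_{μ,j} (2π iʲ J_j(y))) =
(Π_μ W_{μ,0})·(2π J_0(y))^d`. [folklore] -/
private theorem prod_sum_range_one_eps_mul (W : Fin d → ℕ → ℂ) (y : ℝ) :
    (∏ μ : Fin d, ∑ j ∈ Finset.range (0 + 1), (if j = 0 then (1 : ℂ) else 2)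
        * (W μ j * (2 * π * Complex.I ^ j * (besselJ j y : ℂ))))
      = (∏ μ, W μ 0) * (((2 * π * besselJ 0 y : ℝ)) : ℂ) ^ d := by
  rw [zero_add]
  have h : ∀ μ ∈ (Finset.univ : Finset (Fin d)),
      (∑ j ∈ Finset.range 1, (if j = 0 then (1 : ℂ) else 2)
        * (W μ j * (2 * π * Complex.I ^ j * (besselJ j y : ℂ))))
      = W μ 0 * (((2 * π * besselJ 0 y : ℝ)) : ℂ) := by
    intro μ _
    rw [Finset.range_one, Finset.sum_singleton]
    simp only [if_true, one_mul, pow_zero, mul_one]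
    push_cast
    ring
  rw [Finset.prod_congr rfl h, Finset.prod_mul_distrib, Finset.prod_const, Finset.card_univ,
    Fintype.card_fin]

/-- The `J = 0` row object SCALES in `β'` by `J_0(β'/d)^d`:
`Obj_{J=0}(β') = J_0(β'/d)^d · (n!)⁻¹∫₀^∞ τⁿ e^{-τ} Re Π_μ W^{(a_μ)}_0(τ/d) dτ`. [folklore] -/
private theorem rowObj_range_one_eq (n : ℕ) (hd0 : 0 < d) (m : ℤ) (a : Fin d → ℕ) (β' : ℝ) :
    (n ! : ℝ)⁻¹ * (∫ τ in Ioi (0:ℝ), τ ^ n * (Real.exp (-τ) *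
      (∏ μ, ∑ j ∈ Finset.range (0 + 1), (if j = 0 then (1 : ℂ) else 2)
        * ((∑ s ∈ Finset.range (a μ + 1), (((a μ).choose s : ℂ) / 2 ^ (a μ))
            * (besselI (j * m - ((2 * (s : ℤ) - (a μ : ℕ) : ℤ))) (τ / d) : ℂ))
          * (2 * π * Complex.I ^ j * (besselJ j (β' / d) : ℂ)))).re)) / (2 * π) ^ d
    = besselJ 0 (β' / d) ^ d * ((n ! : ℝ)⁻¹ * ∫ τ in Ioi (0:ℝ), τ ^ n * (Real.exp (-τ) *
      (∏ μ, ∑ s ∈ Finset.range (a μ + 1), (((a μ).choose s : ℂ) / 2 ^ (a μ))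
            * (besselI ((0 : ℕ) * m - ((2 * (s : ℤ) - (a μ : ℕ) : ℤ))) (τ / d) : ℂ)).re)) := by
  have hd0' : (0 : ℝ) < d := by exact_mod_cast hd0
  have hπ : (0 : ℝ) < π := Real.pi_pos
  have hint : ∀ τ : ℝ, τ ^ n * (Real.exp (-τ) *
      (∏ μ, ∑ j ∈ Finset.range (0 + 1), (if j = 0 then (1 : ℂ) else 2)
        * ((∑ s ∈ Finset.range (a μ + 1), (((a μ).choose s : ℂ) / 2 ^ (a μ))
            * (besselI (j * m - ((2 * (s : ℤ) - (a μ : ℕ) : ℤ))) (τ / d) : ℂ))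
          * (2 * π * Complex.I ^ j * (besselJ j (β' / d) : ℂ)))).re)
      = (2 * π * besselJ 0 (β' / d)) ^ d * (τ ^ n * (Real.exp (-τ) *
        (∏ μ, ∑ s ∈ Finset.range (a μ + 1), (((a μ).choose s : ℂ) / 2 ^ (a μ))
            * (besselI ((0 : ℕ) * m - ((2 * (s : ℤ) - (a μ : ℕ) : ℤ))) (τ / d) : ℂ)).re)) := by
    intro τ
    rw [prod_sum_range_one_eps_mul (fun μ j => ∑ s ∈ Finset.range (a μ + 1),
      (((a μ).choose s : ℂ) / 2 ^ (a μ)) * (besselI (j * m - ((2 * (s : ℤ) - (a μ : ℕ) : ℤ))) (τ / d) : ℂ))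
      (β' / d), ← Complex.ofReal_pow, Complex.re_mul_ofReal]
    ring
  simp_rw [hint]
  rw [integral_const_mul, mul_pow]
  field_simp

/-- At `β = 0` the `J = 0` row object is EXACT (`δ_0(0) = 0`): for `m ≠ 0`, `|m| ≥ M ≥ a_max`,
`Tw^{Πcos^{a}}_{n+1}(m e_i; 0) = Obj_{J=0}(0)`. [folklore] -/
private theorem srwTwist_prodCosPow_zero_right_eq_rowObj (n : ℕ) (hd : 2 * (n + 1) + 1 ≤ d)
    (i : Fin d) {m : ℤ} (hm : m ≠ 0) (a : Fin d → ℕ) (M amax : ℕ) (hM : M ≤ m.natAbs)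
    (ha : ∀ μ, a μ ≤ amax) (hamax : amax ≤ M) :
    srwTwist d (n + 1) (fun k => ∏ μ, Real.cos (k μ) ^ a μ) (Pi.single i m) 0
      = (n ! : ℝ)⁻¹ * (∫ τ in Ioi (0:ℝ), τ ^ n * (Real.exp (-τ) *
      (∏ μ, ∑ j ∈ Finset.range (0 + 1), (if j = 0 then (1 : ℂ) else 2)
        * ((∑ s ∈ Finset.range (a μ + 1), (((a μ).choose s : ℂ) / 2 ^ (a μ))
            * (besselI (j * m - ((2 * (s : ℤ) - (a μ : ℕ) : ℤ))) (τ / d) : ℂ))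
          * (2 * π * Complex.I ^ j * (besselJ j ((0:ℝ) / d) : ℂ)))).re)) / (2 * π) ^ d := by
  have hamax' : amax ≤ (0 + 1) * M := by simpa using hamax
  have h := abs_srwTwist_prodCosPow_sub_rowTrunc_le_sum_srwI n hd i hm 0 a 0 M amax hM ha hamax'
  have hδ : (∑' l : ℕ, |besselJ (l + 0 + 1) ((0:ℝ) / d)|) = 0 := by
    rw [zero_div]
    simp only [add_zero, besselJ_succ_apply_zero, abs_zero, tsum_zero]
  rw [hδ] at h
  simp only [mul_zero, ne_eq, Nat.succ_ne_zero, not_false_eq_true, zero_pow, zero_mul,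
    Finset.sum_const_zero] at h
  exact sub_eq_zero.1 (abs_nonpos_iff.1 h)

/-- **The `β = 0` mass of a product cosine-power weight in `u`-representation**: for `d ≥ 2n+3`
and ANY node `x`,
`Tw^{Π_μ cos^{a_μ}}_{n+1}(x; 0) = (n!)⁻¹ ∫₀^∞ τⁿ e^{-τ} Re Π_μ W^{(a_μ)}_0(τ/d) dτ`,
`W^{(a)}_0(v) = 2^{-a} Σ_{s≤a} C(a,s) I_{-(2s−a)}(v)` — a one-dimensional integral of `e^{-τ}` times a
product of finite Bessel-`I` sums, with no `π`, no `m`, no `β`: the main-term factor of the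
`m`-uniform device below, priced by a kernel like any exact row object.
[cite: FitznerVanDerHofstad2016NoBLE, (3.34)–(3.36) p. 1071, §5.1.1 (5.2)–(5.5); DLMF, 10.35.2, 10.32.3] -/
theorem srwTwist_prodCosPow_zero_right_eq_integral (n : ℕ) (hd : 2 * (n + 1) + 1 ≤ d)
    (a : Fin d → ℕ) (x : Fin d → ℤ) :
    srwTwist d (n + 1) (fun k => ∏ μ, Real.cos (k μ) ^ a μ) x 0
      = (n ! : ℝ)⁻¹ * ∫ τ in Ioi (0:ℝ), τ ^ n * (Real.exp (-τ) *
        (∏ μ, ∑ s ∈ Finset.range (a μ + 1), (((a μ).choose s : ℂ) / 2 ^ (a μ))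
            * (besselI (-((2 * (s : ℤ) - (a μ : ℕ) : ℤ))) (τ / d) : ℂ)).re) := by
  have hd0 : 0 < d := by omega
  obtain ⟨amax, ha⟩ : ∃ amax : ℕ, ∀ μ, a μ ≤ amax :=
    ⟨Finset.univ.sup a, fun μ => Finset.le_sup (Finset.mem_univ μ)⟩
  have hm : ((amax : ℤ) + 1) ≠ 0 := by omega
  have hM : amax + 1 ≤ ((amax : ℤ) + 1).natAbs := by omega
  rw [srwTwist_zero_right_eq (n + 1) _ x (Pi.single ⟨0, hd0⟩ ((amax : ℤ) + 1)),
    srwTwist_prodCosPow_zero_right_eq_rowObj n hd ⟨0, hd0⟩ hm a (amax + 1) amax hM ha (by omega),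
    rowObj_range_one_eq n hd0 _ a 0, zero_div, besselJ_zero_zero, one_pow, one_mul]
  simp only [Nat.cast_zero, zero_mul, zero_sub]

/-- **The m-uniform device for product cosine-power twisted seeds** (`J = 0`). For `d ≥ 2n+3`,
`m ≠ 0`, `|m| ≥ M` and `a_μ ≤ a_max ≤ M`:
`|Tw^{Π_μ cos^{a_μ}}_{n+1}(m e_i; β) − J_0(β/d)^d · Tw^{Π_μ cos^{a_μ}}_{n+1}(m e_i; 0)|`
`≤ Σ_{k<d} C(d,k+1) (2δ_0(β/d))^{k+1} · srwI d (n+1) 0 ((M − a_max)(e_0+…+e_k))`,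
`δ_0(y) = Σ_{l≥0}|J_{l+1}(y)|` — the main term is `J_0(β/d)^d` times the `β = 0` MASS of the product
weight (node-independent: `srwTwist_zero_right_eq`, `srwTwist_prodCosPow_zero_right_eq_integral`),
the error is plain seeds, and NOTHING on the right depends on `m`: the large-`m` regime of every
weighted slice needs no kernel run.
[cite: FitznerVanDerHofstad2016NoBLE, (3.34)–(3.38) p. 1071, §5.1.1 (5.2)–(5.5); DLMF, 10.35.2, 10.14.4] -/
theorem abs_srwTwist_prodCosPow_sub_besselJ_zero_pow_mul_le (n : ℕ) (hd : 2 * (n + 1) + 1 ≤ d)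
    (i : Fin d) {m : ℤ} (hm : m ≠ 0) (β : ℝ) (a : Fin d → ℕ) (M amax : ℕ) (hM : M ≤ m.natAbs)
    (ha : ∀ μ, a μ ≤ amax) (hamax : amax ≤ M) :
    |srwTwist d (n + 1) (fun k => ∏ μ, Real.cos (k μ) ^ a μ) (Pi.single i m) β
      - besselJ 0 (β / d) ^ d
        * srwTwist d (n + 1) (fun k => ∏ μ, Real.cos (k μ) ^ a μ) (Pi.single i m) 0|
    ≤ ∑ k ∈ Finset.range d, (d.choose (k + 1) : ℝ)
        * (2 * ∑' l : ℕ, |besselJ (l + 1) (β / d)|) ^ (k + 1)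
        * srwI d (n + 1) 0
            (fun μ : Fin d => if (μ : ℕ) < k + 1 then (((M - amax : ℕ)) : ℤ) else 0) := by
  have hd0 : 0 < d := by omega
  have hamax' : amax ≤ (0 + 1) * M := by simpa using hamax
  have hβ := abs_srwTwist_prodCosPow_sub_rowTrunc_le_sum_srwI n hd i hm β a 0 M amax hM ha hamax'
  rw [rowObj_range_one_eq n hd0 m a β] at hβ
  simp only [add_zero, zero_add, one_mul] at hβ
  rw [srwTwist_prodCosPow_zero_right_eq_rowObj n hd i hm a M amax hM ha hamax,
    rowObj_range_one_eq n hd0 m a 0, zero_div, besselJ_zero_zero, one_pow, one_mul]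
  exact hβ

end Literature.Probability.FitznerVanDerHofstad2017
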